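import Literature.Computability.AlgebraicComplexity.TableauEvalLabelMajorImpl
import Literature.Computability.AlgebraicComplexity.ChowPointTableauCertificates
import HarnessLib

/-!
# Label-major evaluation with the fast leaves: power-sum points and products of linear forms

Glue file (cell `val-lit`, DIP20 lane; honest framing below). The label-major programme `evalA`
(`TableauEvalLabelMajor.lean`, correctness `evalA_eq_evalC` in `TableauEvalLabelMajorImpl.lean`) keeps
the state space small for COLUMN-STRICT tableaux with many columns — where the column-bijection
evaluators `evalC` / `evalCPow` / `evalCProd` (`∏_c h_c!` branches) are hopeless, e.g. the two-row generator
`(45,45)` of DIP's Prop. 3.9 (45 columns of height 2). It evaluates the symmetric-tensor entries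
`symEntry P w` only when building its trie (`buildPTrie`), through the naive permanent leaf. This file
makes the trie's entry function a PARAMETER (`buildPTrieWith S`, `evalAWith S`) and instantiates it with
the two fast leaves of the companion files: `symEntryPow` (power-sum points, `ExplicitPointTableauCertificates`)
and `symEntryProd` (sums of products of linear forms, `ChowPointTableauCertificates`):

* `evalAPow m L N = evalC (powPoint m L) N` (`evalAPow_eq_evalC`) and
* `evalAProd P N = evalC P N` (`evalAProd_eq_evalC`),

for column-strict networks passing the weak structural check (columns in any order). The proofs are
the tree's `layerSum_layersA` + `specL_eq_evalC` with the leaf identities `symEntry_eq_S`,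
`symEntry_eq_symEntryProd`.

HONEST FRAMING: certificate-checking plumbing for the toy model `Pow ⊄ Ch` of DIP 2020 (generator
positivity Props. 3.9 / 7.1, positivity certificates Prop. 5.1); nothing here bears on permanent versus
determinant; VP ≠ VNP is not proved.

## References
* [DorflerIkenmeyerPanova2020] J. Dörfler, C. Ikenmeyer, G. Panova, *On geometric complexity theory:
  multiplicity obstructions are stronger than occurrence obstructions*, SIAM J. Appl. Algebra Geom. 4
  (2020) = arXiv:1901.04576, §5 (eq. (5.6) and the dynamic programme "we observe that"), Props. 3.9, 5.1, 7.1.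

## Mathlib and tree
Tree: `PTrie`, `layersA`, `layerSum`, `Network.varBound`, `Network.initLayer`, `buildPTrie`, `evalA`
(`TableauEvalLabelMajor`); `layerSum_layersA`, `pairwise_of_columnStrict`, `resid_zero`, `layerSpec`, `finEnum`,
`lt_varBound` (`TableauEvalLabelMajorImpl`); `specL`, `specL_eq_evalC`, `Network.columnStrict`
(`TableauEvalLabelWalk`, `TableauEvalLabelMajorSpec`); `symEntry_eq_S` (`TableauEvalBridge`);
`powPoint`, `symEntryPow`, `Network.checkWeak` (`ExplicitPointTableauCertificates`); `symEntryProd`,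
`symEntry_eq_symEntryProd` (`ChowPointTableauCertificates`); `lperm_eq_permanent`, `matOfRows`
(`PlethysmTableauPerms`).

Provenance: val-lit cell, prover val-lit-p6 g3.
-/

namespace Literature.Computability.AlgebraicComplexity

namespace TableauEval

open MvPolynomial

/-! ## §1 The programme with an arbitrary entry function -/

section With

variable {R : Type*} [CommRing R] [DecidableEq R]

/-- The pruned trie of `S (pre ++ w)` over the words `w` of length `k` with letters `< V` (the tree's
`buildPTrie` is the case `S = symEntry P`). [folklore] -/
def buildPTrieWith (S : List ℕ → R) (V : ℕ) : ℕ → List ℕ → PTrie R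
  | 0, pre => PTrie.mkLeaf (S pre)
  | k + 1, pre => PTrie.mkNode ((List.range V).map fun i => buildPTrieWith S V k (pre ++ [i]))

/-- **Label-major evaluation with the entry function `S`** (the tree's `evalA P` is the case
`S = symEntry P`). [folklore] -/
def evalAWith (S : List ℕ → R) (N : Network) : R :=
  layerSum (layersA N.cols N.varBound (buildPTrieWith S N.varBound N.perLabel [])
    (List.range N.nlabels) N.initLayer)

/-- The trie holds the entries: `find w (buildPTrieWith S V k pre) = S (pre ++ w)` for words of length
`k` with letters `< V`. [folklore] -/
private theorem find_buildPTrieWith (S : List ℕ → R) (V : ℕ) : ∀ (k : ℕ) (pre w : List ℕ),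
    w.length = k → (∀ v ∈ w, v < V) → (buildPTrieWith S V k pre).find w = S (pre ++ w)
  | 0, pre, w, hw, _ => by
    rw [List.length_eq_zero_iff] at hw; subst hw
    simp only [buildPTrieWith, PTrie.mkLeaf, List.append_nil]
    split_ifs with h
    · rw [PTrie.find_empty, h]
    · rfl
  | k + 1, pre, [], hw, _ => by simp at hw
  | k + 1, pre, v :: w, hw, hv => by
    have hvV : v < V := hv v List.mem_cons_self
    have hw' : w.length = k := by simpa using hw
    have IH := find_buildPTrieWith S V k (pre ++ [v]) w hw'
      (fun x hx => hv x (List.mem_cons_of_mem _ hx))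
    rw [List.append_assoc, List.singleton_append] at IH
    simp only [buildPTrieWith, PTrie.mkNode]
    split_ifs with h
    · rw [PTrie.find_empty, ← IH]
      have hmem : buildPTrieWith S V k (pre ++ [v]) ∈
          (List.range V).map fun i => buildPTrieWith S V k (pre ++ [i]) :=
        List.mem_map.mpr ⟨v, List.mem_range.mpr hvV, rfl⟩
      have he := (List.all_eq_true.mp h) _ hmem
      rw [(PTrie.isEmpty_iff _).mp he, PTrie.find_empty]
    · rw [PTrie.find_cons, PTrie.child, List.getD_eq_getElem _ _ (by simpa using hvV)]
      simp only [List.getElem_map, List.getElem_range]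
      exact IH

/-- The programme with entry function `S` computes the specification `specL` with the trie's
entries. [folklore] -/
private theorem evalAWith_eq_specL (S : List ℕ → R) (N : Network) (hcs : N.columnStrict = true) :
    evalAWith S N = specL (fun w => (buildPTrieWith S N.varBound N.perLabel []).find w)
      (List.range N.nlabels) N.cols := by
  unfold evalAWith
  rw [List.range_eq_range', layerSum_layersA N.varBound _ N.cols (pairwise_of_columnStrict N hcs)
    N.nlabels 0 _ (fun e he => by simp [Network.initLayer] at he; subst he; simp)]
  simp [layerSpec, Network.initLayer, resid_zero]

/-- What `Network.checkWeak` guarantees (as in `ExplicitPointTableauCertificates`). [folklore] -/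
private theorem spec_of_checkWeak (N : Network) (h : N.checkWeak = true) :
    (∀ c ∈ N.cols, c.vars.length = c.labels.length) ∧
      (∀ c ∈ N.cols, ∀ u ∈ c.labels, u < N.nlabels) ∧
      (∀ u, u < N.nlabels → countNat u N.allLabels = N.perLabel) := by
  simp only [Network.checkWeak, Bool.and_eq_true, List.all_eq_true, beq_iff_eq, decide_eq_true_eq,
    List.mem_range] at h
  obtain ⟨⟨h1, h3⟩, h4⟩ := h
  refine ⟨fun c hc => h1 c hc, fun c hc u hu => h3 u ?_, h4⟩
  exact List.mem_flatMap.mpr ⟨c, hc, hu⟩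

/-- **The programme with an entry function that agrees with `symEntry P` on the relevant words computes
`evalC P N`** (column-strict networks passing the weak check; `m` forms per term).
[cite: DorflerIkenmeyerPanova2020, §5 eq. (5.6) and the dynamic programme (arXiv p. 13)] -/
theorem evalAWith_eq_evalC (S : List ℕ → R) (P : Point R) (N : Network)
    (hP : ∀ t : Fin P.terms.length, (P.terms.get t).2.length = N.perLabel)
    (hN : N.checkWeak = true) (hcs : N.columnStrict = true)
    (hS : ∀ w : List ℕ, w.length = N.perLabel → (∀ v ∈ w, v < N.varBound) → S w = symEntry P w) :
    evalAWith S N = evalC P N := by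
  obtain ⟨hlen, hlab, hcnt⟩ := spec_of_checkWeak N hN
  have hV : 0 < N.varBound := Nat.succ_pos _
  let E := finEnum N.varBound hV
  rw [evalAWith_eq_specL S N hcs]
  refine specL_eq_evalC E P N hP hlen (fun c hc v hv => lt_varBound N c hc v hv) hlab hcnt hcs _
    fun w hw hv => ?_
  rw [← symEntry_eq_S E P hP w hw hv, find_buildPTrieWith S N.varBound N.perLabel [] w hw hv,
    List.nil_append, hS w hw hv]

end With

/-! ## §2 Power-sum points -/

section Pow

variable {R : Type*} [CommRing R] [DecidableEq R]

/-- **Label-major evaluation at a power-sum point** `∑_t c_t ℓ_t^m` (leaf `symEntryPow`). [folklore] -/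
def evalAPow (m : ℕ) (L : List (R × List R)) (N : Network) : R := evalAWith (symEntryPow m L) N

omit [DecidableEq R] in
/-- The permanent of `m` equal rows `r` (of length `m`) is `m! · ∏ r`. [folklore] -/
private theorem lperm_replicate' (m : ℕ) (r : List R) (hr : r.length = m) :
    lperm (List.replicate m r) = (m.factorial : R) * r.prod := by
  rw [lperm_eq_permanent (List.replicate m r) (List.length_replicate ..), Matrix.permanent]
  have hM : ∀ σ : Equiv.Perm (Fin m), ∏ i : Fin m, matOfRows m (List.replicate m r) (σ i) i =
      r.prod := by
    intro σ
    have h1 : ∀ i : Fin m, matOfRows m (List.replicate m r) (σ i) i = r.getD i 0 := by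
      intro i
      simp only [matOfRows, Matrix.of_apply]
      rw [List.getD_eq_getElem (List.replicate m r) [] (by simp), List.getElem_replicate]
    simp only [h1]
    subst hr
    rw [← List.prod_ofFn]
    congr 1
    apply List.ext_getElem (by simp)
    intro i h1 h2
    rw [List.getElem_ofFn, List.getD_eq_getElem]
  simp only [hM, Finset.sum_const, Finset.card_univ, Fintype.card_perm, Fintype.card_fin,
    nsmul_eq_mul]

omit [DecidableEq R] in
/-- At a power-sum point the naive leaf is the closed leaf (words of length `m`). [folklore] -/
private theorem symEntry_powPoint' (m : ℕ) (L : List (R × List R)) (idx : List ℕ)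
    (hidx : idx.length = m) : symEntry (powPoint m L) idx = symEntryPow m L idx := by
  unfold symEntry symEntryPow powPoint
  rw [List.map_map]
  congr 1
  refine List.map_congr_left fun cl _ => ?_
  simp only [Function.comp_apply, List.map_replicate]
  rw [lperm_replicate' m _ (by rw [List.length_map, hidx])]

/-- **`evalAPow` computes `evalC` at the power-sum point** for column-strict networks passing the weak
structural check. [cite: DorflerIkenmeyerPanova2020, §5 eq. (5.6) (arXiv p. 13)] -/
theorem evalAPow_eq_evalC (m : ℕ) (L : List (R × List R)) (N : Network) (hN : N.checkWeak = true)
    (hcs : N.columnStrict = true) (hm : N.perLabel = m) :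
    evalAPow m L N = evalC (powPoint m L) N := by
  unfold evalAPow
  refine evalAWith_eq_evalC _ _ N ?_ hN hcs ?_
  · intro t
    have hall : ∀ t' ∈ (powPoint m L).terms, t'.2.length = m := by
      intro t' ht'
      simp only [powPoint, List.mem_map] at ht'
      obtain ⟨cl, -, rfl⟩ := ht'
      exact List.length_replicate ..
    rw [hm]
    exact hall _ (List.get_mem _ _)
  · intro w hw _
    rw [hm] at hw
    exact (symEntry_powPoint' m L w hw).symm

end Pow

/-! ## §3 Sums of products of linear forms -/

section Prod

variable {R : Type*} [CommRing R] [DecidableEq R]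

/-- **Label-major evaluation at a sum of products of linear forms** (leaf `symEntryProd` on the
network's own variable bound). [folklore] -/
def evalAProd (P : Point R) (N : Network) : R := evalAWith (symEntryProd N.varBound P) N

/-- **`evalAProd` computes `evalC`** for column-strict networks passing the weak structural check, at
points all of whose terms have `perLabel` forms. [cite: DorflerIkenmeyerPanova2020, §5 eq. (5.6) (arXiv p. 13)] -/
theorem evalAProd_eq_evalC (P : Point R) (N : Network) (hN : N.checkWeak = true)
    (hcs : N.columnStrict = true)
    (hP : ∀ t : Fin P.terms.length, (P.terms.get t).2.length = N.perLabel) :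
    evalAProd P N = evalC P N := by
  unfold evalAProd
  haveI : NeZero N.varBound := ⟨Nat.succ_ne_zero _⟩
  refine evalAWith_eq_evalC _ P N hP hN hcs ?_
  intro w hw hv
  exact (symEntry_eq_symEntryProd P hP w hw hv).symm

end Prod

/-! ## §4 One nonzero value certifies positivity (r = 1 certificates with the label-major evaluator) -/

section Positivity

open _root_.Literature.NumberTheory.DiophantineGeometry

variable {N : ℕ} [NeZero N]

/-- **Positivity certificate at a power-sum point, label-major form**: a column-strict network of shape `λ`
(weak check, canonical alternators, `m` boxes per label) and an integer power-sum point `∑_{t<k} ℓ_t^m`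
with `evalAPow m L N ≠ 0` give `1 ≤ mult_{λ^*} K[Pow_{N,k}^m]`, hence `a_{λ^*} ≥ 1`. Meant for the
many-column shapes of DIP's generator Propositions 3.9 / 7.1 (e.g. `(45,45)`, "by Sturmfels' formula" in
print). [cite: DorflerIkenmeyerPanova2020, Prop. 3.9 (proof, arXiv p. 6) and §5–§6] -/
theorem one_le_coordRingMultiplicity_powerSumSet_of_evalAPow (K : Type) [Field K] [CharZero K]
    {m d k e : ℕ} (hm : m ≠ 0) (lam : Nat.Partition e) (lamL : List ℕ)
    (hlamL : lam.sortedParts = lamL) (hlen : lamL.length ≤ N) (Nw : Network)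
    (hN : Nw.checkWeak = true ∧ Nw.canonicalVars = true ∧ Nw.nlabels = d ∧ Nw.perLabel = m ∧
      Nw.shape = lamL)
    (hcs : Nw.columnStrict = true) (L : List (ℤ × List ℤ)) (hL : L.length = k ∧ ∀ cl ∈ L, cl.1 = 1)
    (hv : evalAPow m L Nw ≠ 0) :
    1 ≤ coordRingMultiplicity K (powerSumSet K N k m) m (Weight.dualOfPartition N lam) := by
  classical
  obtain ⟨hcheck, hcan, hd, hperm, hshape⟩ := hN
  let nets : Fin 1 → Network := fun _ => Nw
  let pts : Fin 1 → Point ℤ := fun _ => powPoint m L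
  have hpts : ∀ b, ∀ t ∈ (pts b).terms, t.2.length = m := by
    intro b t ht
    simp only [pts, powPoint, List.mem_map] at ht
    obtain ⟨cl, -, rfl⟩ := ht
    exact List.length_replicate ..
  have hZ : ∀ b, splfPoly (coefM ((pts b).map (Int.castRingHom K)))
      (formM (finRevEnum N) ((pts b).map (Int.castRingHom K)) m) ∈ powerSumSet K N k m := by
    intro b
    rw [show (pts b).map (Int.castRingHom K) = powPoint m (L.map fun cl =>
        ((Int.castRingHom K) cl.1, cl.2.map (Int.castRingHom K))) from by
      simp only [pts, powPoint, Point.map, List.map_map]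
      congr 1
      refine List.map_congr_left fun cl _ => ?_
      simp [List.map_replicate]]
    have h := splfPoly_powPoint_mem_powerSumSet (N := N) K m
      (L.map fun cl => ((Int.castRingHom K) cl.1, cl.2.map (Int.castRingHom K)))
      (fun cl hcl => by
        obtain ⟨cl₀, h0, rfl⟩ := List.mem_map.mp hcl
        simp [hL.2 cl₀ h0])
    rwa [List.length_map, hL.1] at h
  have hdet : (Matrix.of fun a b => evalC (pts b) (nets a)).det ≠ 0 := by
    rw [Matrix.det_fin_one, Matrix.of_apply]
    show evalC (powPoint m L) Nw ≠ 0
    rw [← evalAPow_eq_evalC m L Nw hcheck hcs hperm]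
    exact hv
  exact le_coordRingMultiplicity_of_certificate' K hm lam lamL hlamL hlen nets (fun _ => hcheck)
    (fun _ => hcan) (fun _ => hd) (fun _ => hperm) (fun _ => hshape) pts hpts _ hZ hdet

/-- **Hence the plethysm coefficient is positive**: `0 < a_{λ^*} = plethysmCoeff K (Fin N) m λ^*`
(`mult ≤ a`, `coordRingMultiplicity_le_plethysmCoeff`). [cite: DorflerIkenmeyerPanova2020, Prop. 3.9 (proof, arXiv p. 6)] -/
theorem plethysmCoeff_pos_of_evalAPow (K : Type) [Field K] [CharZero K]
    {m d k e : ℕ} (hm : m ≠ 0) (lam : Nat.Partition e) (lamL : List ℕ)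
    (hlamL : lam.sortedParts = lamL) (hlen : lamL.length ≤ N) (Nw : Network)
    (hN : Nw.checkWeak = true ∧ Nw.canonicalVars = true ∧ Nw.nlabels = d ∧ Nw.perLabel = m ∧
      Nw.shape = lamL)
    (hcs : Nw.columnStrict = true) (L : List (ℤ × List ℤ)) (hL : L.length = k ∧ ∀ cl ∈ L, cl.1 = 1)
    (hv : evalAPow m L Nw ≠ 0) :
    0 < plethysmCoeff K (Fin N) m (Weight.dualOfPartition N lam) :=
  lt_of_lt_of_le Nat.zero_lt_one
    ((one_le_coordRingMultiplicity_powerSumSet_of_evalAPow K hm lam lamL hlamL hlen Nw hN hcs L hL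
      hv).trans (coordRingMultiplicity_le_plethysmCoeff _ _ _))

end Positivity

end TableauEval

end Literature.Computability.AlgebraicComplexity
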